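import Summits.BirchSwinnertonDyer.BirchSwinnertonDyer.Theorems.ClassRecordThreeCornerAtThreeRingClassGalSplitCyclic
import Summits.BirchSwinnertonDyer.BirchSwinnertonDyer.Theorems.ClassRecordThreeCornerAtThreeShimuraSplitAuxNormDefs
import Literature.NumberTheory.EllipticCurves.RingClassFieldDecompositionGroup
import Literature.NumberTheory.EllipticCurves.RingClassFieldDecompositionLaw
import HarnessLib

/-!
# The auxiliary SPLIT level from ONE prime-conductor Chebotarev–Kummer supply: the split stabiliser law PROVED and
# `AuxiliarySplitLevel W K ι p q N ⟸ ‹split auxiliary prime supply at conductor ℓ₀›`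
# (cell `bsd-stepL`, seat `bsd-stepL-corner3-p2` g14 = lane B, LINE OWNER of crux 21420 `CornerAtThreeW`; `--supports stmt-BirchSwinnertonDyer-21420 --as helper`)

WHY. Conjunct (c) of the r17 stub `stub_upper3_residualMulti` of `Cruxes/CornerAtThreeW/Lines/inert.lean` is `ShimuraWalk.AuxiliarySplitLevel W K ι 3 q N`
on the corner frames (`…ShimuraSplitAuxNormDefs`, p642549): at every guarded level `m₀` an auxiliary prime `ℓ₀ ∤ N m₀` SPLIT and PRINCIPAL over `K[m₀]`
with `p ∤ a_{ℓ₀} − 2`, a generator `σ` of `G_{ℓ₀}` with `σ^{ℓ₀−1} = 1`, and `p^e ∣ #Stab_{⟨σ⟩}(w̃)` at the primes `w̃ ∣ q` of `K[ℓ₀ m₀]`. Exactly as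
bsd-idea-9 g8's INERT receptacle (`auxiliaryInertLevel_of_laws`: S3 ⟸ S2♭ relative stabiliser law + S3♭ prime-conductor supply; S2♭ proved by
er5-w4 g8), THIS FILE splits (c) into
* §1 `relativeStabilizerLawSplit` — **PROVED**: for an odd prime `ℓ₀ ∤ m₀` SPLIT in `K` (`d_K < −4`) and any generator `σ` of
  `G_{ℓ₀} = ringClassGalOver ι (ℓ₀ m₀) m₀`: `σ^{ℓ₀−1} = 1` (lane B g14's `RingClassSplit.isCyclic_and_natCard_ringClassGalOver_of_ncard_primesOver_eq_two`,
  `#G_{ℓ₀} = ℓ₀ − 1`) and, at every prime `w ∋ q` of `K[ℓ₀ m₀]` (`q ∤ ℓ₀ m₀`), `#Stab_{⟨σ⟩}(w) · orderOf [𝔭_v]_{m₀} = orderOf [𝔭_v]_{ℓ₀ m₀}` for a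
  prime `v ∋ q` of `K` (the tree's `card_stabilizer_mul_orderOf_primeClass_of_zpowers_eq`, `ℓ`-type-free);
* §2 `auxiliarySplitLevel_of_primeSupply` — **`AuxiliarySplitLevel W K ι p q N ⟸` the split prime-conductor supply** `hS`: for all `E` and all
  guarded `m₀`, an odd prime `ℓ₀ ∤ N m₀` split in `K`, principal over `K[m₀]` (`[𝔩]_{m₀} = 1` for both `𝔩 ∣ ℓ₀`), with `p ∤ a_{ℓ₀} − 2` and
  `p^E ∣ orderOf [𝔭_v]_{ℓ₀}` for the primes `v ∣ q` of `K` — ONE Chebotarev–Kummer class in `K[m₀](E[p], μ_{p^E}, 𝔮^{1/p^E})/ℚ` (memo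
  CORNER3-G14 §2: on the corner `Frob = −I`, `−I ∈ [G,G]`). Glue = idea-9's VERBATIM with `ℓ₀ + 1 ↦ ℓ₀ − 1`: `E := e + ord_p #Pic(𝒪_{m₀})`,
  `orderOf [𝔭_v]_{ℓ₀} ∣ orderOf [𝔭_v]_{ℓ₀m₀} = #Stab · orderOf [𝔭_v]_{m₀}` and `orderOf [𝔭_v]_{m₀} ∣ #Pic(𝒪_{m₀})`.
So stub (c) = ONE prime-conductor Chebotarev–Kummer statement (the hypothesis `hS`, inline; the planner may name it) — the split twin of idea-9's
`AuxiliaryPrimeSupply`, whose inert version is VOID on the corner's 3Ns images (lane B g13 p638602) while this one is consistent there (memo §2).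
HONEST FRAMING: THEOREMS ONLY (no definition, no named fact, no `sorry`); `hS` is a HYPOTHESIS (Chebotarev-grade, not proved here); nothing closes;
21420 OPEN; no census label moves (T7); BSD is proved for no curve.
-- adapted from Summits/…/Cruxes/EulerHalfNotRamNoInertSetAtFive/Lines/aux_norm_receptacle.lean (bsd-idea-9 g8) `auxiliaryInertLevel_of_laws` and
-- Summits/…/Theorems/ErratumRoadFiveAuxNormRelativeStabilizerLaw.lean (er5-w4 g8) `relativeStabilizerLaw`: inert ↦ split, `ℓ₀ + 1 ↦ ℓ₀ − 1`.
References (locators only): [cite: GrossLMS1991, §3 (p. 239)] [cite: NeukirchANT1999, Ch. I §9 (9.6); Ch. VI §7 (7.3)] [cite: Cox2013, §7.D Thm. 7.24, Thm. 8.12, §9.A]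
[cite: Darmon2004, Prop. 3.10] [cite: Kobayashi2013, §5 p. 612]. presearch: as `…RingClassGalSplitCyclic` (in-tree). Axioms: the trio.
-/

set_option autoImplicit false
set_option linter.dupNamespace false

noncomputable section

open scoped Classical NumberField Pointwise

namespace Summit.BirchSwinnertonDyer.BirchSwinnertonDyer.Theorems.ShimuraWalk

open WeierstrassCurve NumberField IsDedekindDomain Module Literature.NumberTheory.EllipticCurves
  Literature.NumberTheory.EllipticCurves.RingClassField
  Literature.NumberTheory.NumberFields Literature.NumberTheory.NumberFields.RingClassField
  Literature.NumberTheory.QuadraticFields Literature.NumberTheory.QuadraticFields.RingClass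
  Summit.BirchSwinnertonDyer.Rank1Residual.X11b

variable {K : Type} [Field K] [NumberField K]

/-! ## §1 The relative stabiliser law at a SPLIT auxiliary prime — PROVED -/

/-- **The split relative stabiliser law, PROVED.** `K` imaginary quadratic with `d_K < −4` and its ring class tower `K[·] ⊂ ℂ`, `q` a rational
prime; for all `m₀ ≥ 1`, odd primes `ℓ₀ ∤ m₀` SPLIT in `K` with `q ∤ ℓ₀ m₀`, and generators `σ` of `G_{ℓ₀} = ringClassGalOver ι (ℓ₀ m₀) m₀`:
`σ^{ℓ₀−1} = 1` (`#G_{ℓ₀} = ℓ₀ − 1`, lane B g14's `RingClassSplit.isCyclic_and_natCard_ringClassGalOver_of_ncard_primesOver_eq_two`), and every prime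
`w ∋ q` of `K[ℓ₀ m₀]` lies over a prime `v ∋ q` of `K` with `#Stab_{⟨σ⟩}(w) · orderOf [𝔭_v]_{m₀} = orderOf [𝔭_v]_{ℓ₀ m₀}` (the tree's
`card_stabilizer_mul_orderOf_primeClass_of_zpowers_eq`). The split twin of er5-w4 g8's `AuxNormReceptacle.relativeStabilizerLaw`.
[cite: GrossLMS1991, §3 (p. 239)] [cite: NeukirchANT1999, Ch. I §9 (9.6); Ch. VI §7 Thm. (7.3)] [cite: Cox2013, §7.D Thm. 7.24, §9.A] -/
theorem relativeStabilizerLawSplit (hK : IsImaginaryQuadratic K) (hD : NumberField.discr K < -4) (ι : K →+* ℂ)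
    [∀ j : ℕ, NumberField (ringClassField K ι j)] (q : ℕ) [Fact q.Prime] :
    ∀ m₀ ℓ₀ : ℕ, m₀ ≠ 0 → ℓ₀.Prime → ℓ₀ ≠ 2 → ¬ ℓ₀ ∣ m₀ → ((Ideal.span {(ℓ₀ : ℤ)}).primesOver (𝓞 K)).ncard = 2 →
    ¬ q ∣ ℓ₀ * m₀ →
    ∀ σ : ringClassField K ι (ℓ₀ * m₀) ≃ₐ[ℚ] ringClassField K ι (ℓ₀ * m₀),
      Subgroup.zpowers σ = ringClassGalOver ι (ℓ₀ * m₀) m₀ →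
      σ ^ (ℓ₀ - 1) = 1 ∧
      ∀ w : HeightOneSpectrum (𝓞 (ringClassField K ι (ℓ₀ * m₀))),
        ((q : ℕ) : 𝓞 (ringClassField K ι (ℓ₀ * m₀))) ∈ w.asIdeal →
        ∃ v : HeightOneSpectrum (𝓞 K), ((q : ℕ) : 𝓞 K) ∈ v.asIdeal ∧
          Nat.card (MulAction.stabilizer (Subgroup.zpowers σ) w.asIdeal) * orderOf (primeClass m₀ v) =
            orderOf (primeClass (ℓ₀ * m₀) v) := by
  have hq : q.Prime := Fact.out
  intro m₀ ℓ₀ hm₀ hℓ₀ hℓ₀2 hℓ₀m hsplit hqn σ hσ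
  have hn : ℓ₀ * m₀ ≠ 0 := mul_ne_zero hℓ₀.ne_zero hm₀
  have hcop : Nat.Coprime ℓ₀ m₀ := (Nat.Prime.coprime_iff_not_dvd hℓ₀).mpr hℓ₀m
  refine ⟨?_, fun w hqw ↦ ?_⟩
  · have hcard := (RingClassSplit.isCyclic_and_natCard_ringClassGalOver_of_ncard_primesOver_eq_two hK hD ι hm₀ hℓ₀ hℓ₀2
      hcop hsplit).2
    rw [← hσ, Nat.card_zpowers] at hcard
    exact orderOf_dvd_iff_pow_eq_one.mp (by rw [hcard])
  -- the prime `v = w ∩ 𝓞 K` below `w`: it contains `q`, hence not `ℓ₀ m₀`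
  have hqv : (q : 𝓞 K) ∈ w.asIdeal.under (𝓞 K) := by
    rw [Ideal.mem_comap, map_natCast]; exact hqw
  have hvne : w.asIdeal.under (𝓞 K) ≠ ⊥ := fun h ↦ by
    rw [h, Ideal.mem_bot] at hqv
    exact hq.ne_zero (by exact_mod_cast hqv)
  let v : HeightOneSpectrum (𝓞 K) := ⟨w.asIdeal.under (𝓞 K), inferInstance, hvne⟩
  haveI : w.asIdeal.LiesOver v.asIdeal := ⟨rfl⟩
  have hv : ¬ Ideal.span {((ℓ₀ * m₀ : ℕ) : 𝓞 K)} ≤ v.asIdeal := by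
    rw [Ideal.span_singleton_le_iff_mem]
    intro hf
    obtain ⟨a, b, hab⟩ := Nat.isCoprime_iff_coprime.mpr ((Nat.Prime.coprime_iff_not_dvd hq).mpr hqn)
    apply v.isPrime.ne_top
    rw [Ideal.eq_top_iff_one]
    have h1 : ((a * q + b * (ℓ₀ * m₀ : ℕ) : ℤ) : 𝓞 K) = 1 := by rw [hab]; simp
    rw [← h1]
    push_cast
    have hf' : ((ℓ₀ : 𝓞 K) * (m₀ : 𝓞 K)) ∈ v.asIdeal := by exact_mod_cast hf
    exact Submodule.add_mem _ (Ideal.mul_mem_left _ _ hqv) (Ideal.mul_mem_left _ _ hf')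
  exact ⟨v, hqv, card_stabilizer_mul_orderOf_primeClass_of_zpowers_eq hK ι (dvd_mul_left m₀ ℓ₀) hn hσ hv w⟩

/-! ## §2 `AuxiliarySplitLevel` from the split prime-conductor supply -/

/-- **`AuxiliarySplitLevel W K ι p q N ⟸` ONE split prime-conductor Chebotarev–Kummer supply.** `K` imaginary quadratic with `d_K < −4` and its
ring class tower `K[·] ⊂ ℂ`, primes `p`, `q ∣ N`; the supply `hS`: for every exponent `E` and every guarded level `m₀` (square-free, prime factors
`∤ N` and inert in `K`) an ODD prime `ℓ₀ ∤ N m₀` SPLIT in `K`, PRINCIPAL over `K[m₀]` (`primeClass m₀ v = 1` for the primes `v ∣ ℓ₀` of `K`), with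
`p ∤ a_{ℓ₀}(E) − 2` and `p^E ∣ orderOf [𝔭_v]_{ℓ₀}` for the primes `v ∣ q` of `K` (prime conductor `ℓ₀`). THEN `AuxiliarySplitLevel W K ι p q N`:
take `E := e + ord_p #Pic(𝒪_{m₀})`, a generator `σ` of the cyclic `G_{ℓ₀}` (lane B g14's `RingClassSplit.exists_zpowers_eq_ringClassGalOver_of_ncard_primesOver_eq_two`),
§1 for `σ^{ℓ₀−1} = 1` and `#Stab · orderOf [𝔭_v]_{m₀} = orderOf [𝔭_v]_{ℓ₀m₀}`, and `orderOf [𝔭_v]_{ℓ₀} ∣ orderOf [𝔭_v]_{ℓ₀m₀}`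
(`orderOf_primeClass_dvd_of_dvd`), `orderOf [𝔭_v]_{m₀} ∣ #Pic(𝒪_{m₀})`; comparing `p`-adic valuations gives `p^e ∣ #Stab`. CONDITIONAL on `hS`;
nothing booked. -- adapted from bsd-idea-9 g8's `auxiliaryInertLevel_of_laws` (inert ↦ split).
[cite: Cox2013, §7.D Thm. 7.24, Thm. 8.12, §9.A] [cite: GrossLMS1991, §3 (p. 239)] [cite: NeukirchANT1999, Ch. I §9 (9.6)] [cite: Darmon2004, Prop. 3.10] -/
theorem auxiliarySplitLevel_of_primeSupply (W : WeierstrassCurve ℚ) [W.IsElliptic] [W.IsGloballyMinimal]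
    (hK : IsImaginaryQuadratic K) (hD : NumberField.discr K < -4) (ι : K →+* ℂ) [∀ j : ℕ, NumberField (ringClassField K ι j)]
    {p : ℕ} [Fact p.Prime] {q : ℕ} [Fact q.Prime] {N : ℕ} (hqN : q ∣ N)
    (hS : ∀ E m₀ : ℕ, Squarefree m₀ → (∀ r ∈ m₀.primeFactors, ¬ r ∣ N ∧ (Ideal.span {(r : 𝓞 K)}).IsPrime) →
      ∃ ℓ₀ : ℕ, ℓ₀.Prime ∧ ℓ₀ ≠ 2 ∧ ¬ ℓ₀ ∣ N ∧ ¬ ℓ₀ ∣ m₀ ∧ ((Ideal.span {(ℓ₀ : ℤ)}).primesOver (𝓞 K)).ncard = 2 ∧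
        (∀ v : HeightOneSpectrum (𝓞 K), ((ℓ₀ : ℕ) : 𝓞 K) ∈ v.asIdeal → primeClass m₀ v = 1) ∧
        ¬ (p : ℤ) ∣ W.frobeniusTrace ℓ₀ - 2 ∧
        ∀ v : HeightOneSpectrum (𝓞 K), ((q : ℕ) : 𝓞 K) ∈ v.asIdeal → p ^ E ∣ orderOf (primeClass ℓ₀ v)) :
    AuxiliarySplitLevel W K ι p q N := by
  have hp : p.Prime := Fact.out
  have hq : q.Prime := Fact.out
  intro e m₀ hm₀ hg₀
  have hm0 : m₀ ≠ 0 := hm₀.ne_zero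
  haveI : Finite (RingClassGroup K m₀) := finite_ringClassGroup (K := K) (f := m₀) hK.1 hm0
  obtain ⟨ℓ₀, hℓ₀, hℓ₀2, hℓ₀N, hℓ₀m, hsplit, hprin, haℓ, hord⟩ :=
    hS (e + (Nat.card (RingClassGroup K m₀)).factorization p) m₀ hm₀ hg₀
  have hℓ₀q : ℓ₀ ≠ q := by
    rintro rfl
    exact hℓ₀N hqN
  have hqm : ¬ q ∣ m₀ := fun h ↦ (hg₀ q (Nat.mem_primeFactors.mpr ⟨hq, h, hm0⟩)).1 hqN
  have hqM : ¬ q ∣ ℓ₀ * m₀ := fun h ↦ ((Nat.Prime.dvd_mul hq).mp h).elim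
    (fun h1 ↦ hℓ₀q ((Nat.prime_dvd_prime_iff_eq hq hℓ₀).mp h1).symm) hqm
  have hcop : Nat.Coprime ℓ₀ m₀ := (Nat.Prime.coprime_iff_not_dvd hℓ₀).mpr hℓ₀m
  obtain ⟨σ, hσ, -⟩ :=
    RingClassSplit.exists_zpowers_eq_ringClassGalOver_of_ncard_primesOver_eq_two hK hD ι hm0 hℓ₀ hℓ₀2 hcop hsplit
  obtain ⟨hσn, hst⟩ := relativeStabilizerLawSplit hK hD ι q m₀ ℓ₀ hm0 hℓ₀ hℓ₀2 hℓ₀m hsplit hqM σ hσ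
  refine ⟨ℓ₀, hℓ₀, hℓ₀N, hℓ₀m, hsplit, hprin, haℓ, σ, hσ, hσn, fun w hw ↦ ?_⟩
  obtain ⟨v, hqv, hmul⟩ := hst w hw
  -- `v ∤ ℓ₀ m₀` since `q ∈ v` and `q ∤ ℓ₀ m₀`
  have hv' : ¬ Ideal.span {((ℓ₀ * m₀ : ℕ) : 𝓞 K)} ≤ v.asIdeal := by
    intro hle
    have hmem : ((ℓ₀ * m₀ : ℕ) : 𝓞 K) ∈ v.asIdeal := hle (Ideal.mem_span_singleton_self _)
    obtain ⟨a, b, hab⟩ : IsCoprime ((ℓ₀ * m₀ : ℕ) : ℤ) (q : ℤ) :=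
      Nat.isCoprime_iff_coprime.mpr (Nat.Coprime.symm ((Nat.Prime.coprime_iff_not_dvd hq).mpr hqM))
    have h1 : ((a * (ℓ₀ * m₀ : ℕ) + b * q : ℤ) : 𝓞 K) ∈ v.asIdeal := by
      push_cast
      exact v.asIdeal.add_mem (v.asIdeal.mul_mem_left _ (by exact_mod_cast hmem))
        (v.asIdeal.mul_mem_left _ hqv)
    rw [hab, Int.cast_one] at h1
    exact v.isPrime.ne_top ((Ideal.eq_top_iff_one _).mpr h1)
  have hdvd : orderOf (primeClass ℓ₀ v) ∣ orderOf (primeClass (ℓ₀ * m₀) v) :=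
    orderOf_primeClass_dvd_of_dvd (dvd_mul_right ℓ₀ m₀) hv'
  have hE : p ^ (e + (Nat.card (RingClassGroup K m₀)).factorization p) ∣
      Nat.card (MulAction.stabilizer (Subgroup.zpowers σ) w.asIdeal) * orderOf (primeClass m₀ v) := by
    rw [hmul]; exact (hord v hqv).trans hdvd
  -- sizes: both factors are nonzero, and `ord_p orderOf [𝔭_v]_{m₀} ≤ ord_p #RingClassGroup`
  have hb0 : orderOf (primeClass m₀ v) ≠ 0 := (orderOf_pos (primeClass m₀ v)).ne'
  have hbD : (orderOf (primeClass m₀ v)).factorization p ≤ (Nat.card (RingClassGroup K m₀)).factorization p :=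
    (Nat.factorization_le_iff_dvd hb0 (Nat.card_pos (α := RingClassGroup K m₀)).ne').mpr (orderOf_dvd_natCard _) p
  have hfin : IsOfFinOrder σ :=
    isOfFinOrder_iff_pow_eq_one.mpr ⟨ℓ₀ - 1, Nat.sub_pos_of_lt hℓ₀.one_lt, hσn⟩
  haveI : Finite (Subgroup.zpowers σ) :=
    Nat.finite_of_card_ne_zero (by rw [Nat.card_zpowers]; exact hfin.orderOf_pos.ne')
  have ha0 : Nat.card (MulAction.stabilizer (Subgroup.zpowers σ) w.asIdeal) ≠ 0 := Nat.card_pos.ne'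
  have key := (hp.pow_dvd_iff_le_factorization (mul_ne_zero ha0 hb0)).mp hE
  rw [Nat.factorization_mul ha0 hb0, Finsupp.add_apply] at key
  exact (hp.pow_dvd_iff_le_factorization ha0).mpr (by omega)

end Summit.BirchSwinnertonDyer.BirchSwinnertonDyer.Theorems.ShimuraWalk

end
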